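import Mathlib
import Summits.KontsevichZagierPeriods.KontsevichZagierPeriods.Theorems.InverseLandauTateLiftingLowDimAlgSector
import Summits.KontsevichZagierPeriods.KontsevichZagierPeriods.Theorems.InverseLandauTateLiftingSqrtReduce

/-!
# `TateLifting` (stmt-KontsevichZagierPeriods-9129), line `Sketch` — the square-root extension of the
# low-dimensional algebraic sector

Crux `Summit.KontsevichZagierPeriods.KontsevichZagierPeriods.Theses.InverseLandau.TateLifting` is
Conjecture-1-strength; the line lands the SECTORS on which it is a theorem. Lead c3 landed the
dimension-≤-1 sector with ALGEBRAIC coefficients (`kzKernelConjecture_lowDimAlg`: every vanishing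
`ℤ`-combination of point representations and of representations `[σ, p(x)/q(x)]`, `p, q ∈ ℝ[x]` with
real-algebraic coefficients, `q ≠ 0` on `σ`, is a relation — Baker's theorem inside the calculus). This
file (lead c6, wave c6-2) adjoins the first ALGEBRAIC INTEGRANDS OF GENUS ZERO: representations
`[σ, R(x, √x)]` with `σ ⊆ (0, ∞)` and `R = P/Q`, `P, Q ∈ K[X, Y]`, `K = algebraicClosure ℚ ℝ`
(`Q(x, √x) ≠ 0` on `σ`). By the square substitution `x = t²` (rule (2); `tateLifting_sqrtSubst`, stub 33)
such a representation differs by a relation from `[{t > 0, t² ∈ σ}, 2t·R(t², t)]`, a dimension-one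
representation with algebraic-coefficient RATIONAL integrand (`tateLifting_sqrtReduce`, stub 35); hence
(`sqrtLowDimKernel`) every vanishing `ℤ`-combination of point representations, algebraic-coefficient
rational representations of dimension one and square-root representations is a relation, i.e. lies in
`KZ.relations ⊔ closure T` (`TateLifting_sqrtSector`), and two such representations with the same value
are KZ-equivalent (`kzPeriodConjecture_sqrt`). (Euler's substitutions rationalise every
`R(x, √(ax² + bx + c))`; the case `√x` is the one whose change of variables is already a landed move.)

References: M. Kontsevich, D. Zagier, *Periods* (2001), §1.2 (Conjecture 1, rule (2)); A. Baker,
*Transcendental Number Theory* (1975), Thm 2.1 (through `kzKernelConjecture_lowDimAlg`).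
-/

noncomputable section

open MeasureTheory Set
open Literature.NumberTheory.Transcendental

namespace Summit.KontsevichZagierPeriods.InverseLandau

namespace SqrtSector

/-- **Reduction of the generators**: every generator of the square-root sector — a point representation,
an algebraic-coefficient rational representation of dimension one, or a square-root representation —
differs by a relation from a generator of the low-dimensional algebraic sector (the first two: themselves;
the third: `tateLifting_sqrtReduce`). [cite: KontsevichZagier2001, §1.2 rule (2)] -/
theorem reduce :
    ∀ d ∈ ({d : KZ.FormalRep | (∃ r : KZ.IntegralRep 0, d = KZ.of r) ∨
          ∃ (r : KZ.IntegralRep 1) (p q : Polynomial ℝ), (∀ i, IsAlgebraic ℚ (p.coeff i)) ∧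
            (∀ i, IsAlgebraic ℚ (q.coeff i)) ∧ (∀ x ∈ r.domain, q.eval (x 0) ≠ 0) ∧
            Set.EqOn r.integrand (fun x => p.eval (x 0) / q.eval (x 0)) r.domain ∧ d = KZ.of r} ∪
        {d : KZ.FormalRep | ∃ (P Q : MvPolynomial (Fin 2) (algebraicClosure ℚ ℝ)) (r : KZ.IntegralRep 1),
          (∀ x ∈ r.domain, 0 < x 0) ∧
          (∀ x ∈ r.domain, MvPolynomial.aeval ![x 0, Real.sqrt (x 0)] Q ≠ 0) ∧
          Set.EqOn r.integrand (fun x => MvPolynomial.aeval ![x 0, Real.sqrt (x 0)] P /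
            MvPolynomial.aeval ![x 0, Real.sqrt (x 0)] Q) r.domain ∧ d = KZ.of r}),
      ∃ ℓ ∈ {d : KZ.FormalRep | (∃ r : KZ.IntegralRep 0, d = KZ.of r) ∨
          ∃ (r : KZ.IntegralRep 1) (p q : Polynomial ℝ), (∀ i, IsAlgebraic ℚ (p.coeff i)) ∧
            (∀ i, IsAlgebraic ℚ (q.coeff i)) ∧ (∀ x ∈ r.domain, q.eval (x 0) ≠ 0) ∧
            Set.EqOn r.integrand (fun x => p.eval (x 0) / q.eval (x 0)) r.domain ∧ d = KZ.of r},
        d - ℓ ∈ KZ.relations := by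
  rintro d (hd | ⟨P, Q, r, hpos, hQ, hint, rfl⟩)
  · exact ⟨d, hd, by rw [sub_self]; exact KZ.relations.zero_mem⟩
  · obtain ⟨ρ, p, q, hp, hq, hq0, hpq, hrel⟩ := tateLifting_sqrtReduce P Q r hpos hQ hint
    exact ⟨KZ.of ρ, Or.inr ⟨ρ, p, q, hp, hq, hq0, hpq, rfl⟩, hrel⟩

end SqrtSector

/-- **THE SQUARE-ROOT EXTENSION OF THE LOW-DIMENSIONAL ALGEBRAIC SECTOR (kernel form).** Every vanishing
`ℤ`-combination of: representations over `ℝ⁰`; dimension-one representations with algebraic-coefficient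
rational integrand `p/q` (`q ≠ 0` on the domain); and square-root representations `[σ, P(x,√x)/Q(x,√x)]`
(`σ ⊆ (0,∞)`, `P, Q ∈ K[X,Y]`, `K = algebraicClosure ℚ ℝ`, `Q(x,√x) ≠ 0` on `σ`) — is a relation of the
Kontsevich–Zagier calculus. Proof: flatten the combination, replace each generator by its rational
representative (`SqrtSector.reduce`), transport the vanishing of `eval` by soundness
(`KZ.relations_le_ker_eval_holds`) and apply `kzKernelConjecture_lowDimAlg`. [cite: KontsevichZagier2001, §1.2] -/
theorem sqrtLowDimKernel :
    ∀ c ∈ AddSubgroup.closure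
        ({d : KZ.FormalRep | (∃ r : KZ.IntegralRep 0, d = KZ.of r) ∨
            ∃ (r : KZ.IntegralRep 1) (p q : Polynomial ℝ), (∀ i, IsAlgebraic ℚ (p.coeff i)) ∧
              (∀ i, IsAlgebraic ℚ (q.coeff i)) ∧ (∀ x ∈ r.domain, q.eval (x 0) ≠ 0) ∧
              Set.EqOn r.integrand (fun x => p.eval (x 0) / q.eval (x 0)) r.domain ∧ d = KZ.of r} ∪
          {d : KZ.FormalRep | ∃ (P Q : MvPolynomial (Fin 2) (algebraicClosure ℚ ℝ))
              (r : KZ.IntegralRep 1),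
            (∀ x ∈ r.domain, 0 < x 0) ∧
            (∀ x ∈ r.domain, MvPolynomial.aeval ![x 0, Real.sqrt (x 0)] Q ≠ 0) ∧
            Set.EqOn r.integrand (fun x => MvPolynomial.aeval ![x 0, Real.sqrt (x 0)] P /
              MvPolynomial.aeval ![x 0, Real.sqrt (x 0)] Q) r.domain ∧ d = KZ.of r}),
      KZ.eval c = 0 → c ∈ KZ.relations := by
  intro c hc hev
  classical
  rw [← Submodule.span_int_eq_addSubgroupClosure, Submodule.mem_toAddSubgroup,
    Submodule.mem_span_set'] at hc
  obtain ⟨k, f, g, rfl⟩ := hc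
  choose ℓ hℓ hrel using fun i => SqrtSector.reduce (g i) (g i).2
  have hdiff : ∑ i, f i • ((g i : KZ.FormalRep)) - ∑ i, f i • ℓ i ∈ KZ.relations := by
    rw [← Finset.sum_sub_distrib]
    refine sum_mem fun i _ => ?_
    rw [← smul_sub]
    exact KZ.relations.zsmul_mem (hrel i) _
  have hmem : ∑ i, f i • ℓ i ∈ AddSubgroup.closure
      {d : KZ.FormalRep | (∃ r : KZ.IntegralRep 0, d = KZ.of r) ∨
        ∃ (r : KZ.IntegralRep 1) (p q : Polynomial ℝ), (∀ i, IsAlgebraic ℚ (p.coeff i)) ∧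
          (∀ i, IsAlgebraic ℚ (q.coeff i)) ∧ (∀ x ∈ r.domain, q.eval (x 0) ≠ 0) ∧
          Set.EqOn r.integrand (fun x => p.eval (x 0) / q.eval (x 0)) r.domain ∧ d = KZ.of r} :=
    sum_mem fun i _ => AddSubgroup.zsmul_mem _ (AddSubgroup.subset_closure (hℓ i)) _
  have hev' : KZ.eval (∑ i, f i • ℓ i) = 0 := by
    have h0 := KZ.relations_le_ker_eval_holds hdiff
    rw [AddMonoidHom.mem_ker, map_sub, hev, zero_sub, neg_eq_zero] at h0
    exact h0
  have hker := kzKernelConjecture_lowDimAlg _ hmem hev'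
  have h := KZ.relations.add_mem hdiff hker
  rwa [sub_add_cancel] at h

/-- **The crux on the square-root sector**: every such vanishing combination lies in
`KZ.relations ⊔ closure T` for the Tate set `T` of `TateLifting` (indeed in `KZ.relations`).
[cite: KontsevichZagier2001, §1.2] -/
theorem TateLifting_sqrtSector :
    ∀ c ∈ AddSubgroup.closure
        ({d : KZ.FormalRep | (∃ r : KZ.IntegralRep 0, d = KZ.of r) ∨
            ∃ (r : KZ.IntegralRep 1) (p q : Polynomial ℝ), (∀ i, IsAlgebraic ℚ (p.coeff i)) ∧
              (∀ i, IsAlgebraic ℚ (q.coeff i)) ∧ (∀ x ∈ r.domain, q.eval (x 0) ≠ 0) ∧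
              Set.EqOn r.integrand (fun x => p.eval (x 0) / q.eval (x 0)) r.domain ∧ d = KZ.of r} ∪
          {d : KZ.FormalRep | ∃ (P Q : MvPolynomial (Fin 2) (algebraicClosure ℚ ℝ))
              (r : KZ.IntegralRep 1),
            (∀ x ∈ r.domain, 0 < x 0) ∧
            (∀ x ∈ r.domain, MvPolynomial.aeval ![x 0, Real.sqrt (x 0)] Q ≠ 0) ∧
            Set.EqOn r.integrand (fun x => MvPolynomial.aeval ![x 0, Real.sqrt (x 0)] P /
              MvPolynomial.aeval ![x 0, Real.sqrt (x 0)] Q) r.domain ∧ d = KZ.of r}),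
      KZ.eval c = 0 → c ∈ KZ.relations ⊔ AddSubgroup.closure {d : KZ.FormalRep |
        ∃ (n : ℕ) (P Q : MvPolynomial (Fin (n + 1)) ℚ) (ε ϖ₀ : ℝ) (r : KZ.IntegralRep n), 0 < ε ∧
        (∃ c₀ : ℚ, c₀ ≠ 0 ∧ ∀ z : Fin n → ℝ,
          MvPolynomial.aeval (Fin.snoc z (0 : ℝ) : Fin (n + 1) → ℝ) Q = (c₀ : ℝ)) ∧
        (∀ (z : Fin n → ℝ) (ϖ : ℝ), (∀ i, z i ∈ Set.Icc (0 : ℝ) 1) → ϖ ∈ Set.Ioo 0 ε →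
          MvPolynomial.aeval (Fin.snoc z ϖ : Fin (n + 1) → ℝ) Q ≠ 0) ∧
        (∀ ϖ ∈ Set.Ioo (0 : ℝ) ε, ∫ z in Set.pi Set.univ (fun _ : Fin n => Set.Ioo (0 : ℝ) 1),
          MvPolynomial.aeval (Fin.snoc z ϖ : Fin (n + 1) → ℝ) P /
            MvPolynomial.aeval (Fin.snoc z ϖ : Fin (n + 1) → ℝ) Q = 0) ∧
        IsAlgebraic ℚ ϖ₀ ∧ ϖ₀ ∈ Set.Ioo 0 ε ∧
        r.domain = Set.pi Set.univ (fun _ : Fin n => Set.Ioo (0 : ℝ) 1) ∧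
        Set.EqOn r.integrand (fun z => MvPolynomial.aeval (Fin.snoc z ϖ₀ : Fin (n + 1) → ℝ) P /
          MvPolynomial.aeval (Fin.snoc z ϖ₀ : Fin (n + 1) → ℝ) Q) r.domain ∧
        d = KZ.of r} :=
  fun c hc h0 => AddSubgroup.mem_sup_left (sqrtLowDimKernel c hc h0)

/-- **Conjecture 1 for pairs of square-root / rational representations**: two representations of
dimension one, each either an algebraic-coefficient rational representation or a square-root
representation `[σ ⊆ (0,∞), P(x,√x)/Q(x,√x)]`, with the same value, are KZ-equivalent — e.g.
`[(0,1), dx/(2√x)] ∼ [(0,1), dx]`. [cite: KontsevichZagier2001, §1.2] -/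
theorem kzPeriodConjecture_sqrt (r r' : KZ.IntegralRep 1)
    (hr : (∃ (p q : Polynomial ℝ), (∀ i, IsAlgebraic ℚ (p.coeff i)) ∧ (∀ i, IsAlgebraic ℚ (q.coeff i)) ∧
        (∀ x ∈ r.domain, q.eval (x 0) ≠ 0) ∧
        Set.EqOn r.integrand (fun x => p.eval (x 0) / q.eval (x 0)) r.domain) ∨
      ∃ (P Q : MvPolynomial (Fin 2) (algebraicClosure ℚ ℝ)), (∀ x ∈ r.domain, 0 < x 0) ∧
        (∀ x ∈ r.domain, MvPolynomial.aeval ![x 0, Real.sqrt (x 0)] Q ≠ 0) ∧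
        Set.EqOn r.integrand (fun x => MvPolynomial.aeval ![x 0, Real.sqrt (x 0)] P /
          MvPolynomial.aeval ![x 0, Real.sqrt (x 0)] Q) r.domain)
    (hr' : (∃ (p q : Polynomial ℝ), (∀ i, IsAlgebraic ℚ (p.coeff i)) ∧ (∀ i, IsAlgebraic ℚ (q.coeff i)) ∧
        (∀ x ∈ r'.domain, q.eval (x 0) ≠ 0) ∧
        Set.EqOn r'.integrand (fun x => p.eval (x 0) / q.eval (x 0)) r'.domain) ∨
      ∃ (P Q : MvPolynomial (Fin 2) (algebraicClosure ℚ ℝ)), (∀ x ∈ r'.domain, 0 < x 0) ∧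
        (∀ x ∈ r'.domain, MvPolynomial.aeval ![x 0, Real.sqrt (x 0)] Q ≠ 0) ∧
        Set.EqOn r'.integrand (fun x => MvPolynomial.aeval ![x 0, Real.sqrt (x 0)] P /
          MvPolynomial.aeval ![x 0, Real.sqrt (x 0)] Q) r'.domain)
    (hv : r.value = r'.value) : KZ.Equivalent r r' := by
  -- membership of each representation in the generating set
  have mem : ∀ (s : KZ.IntegralRep 1),
      ((∃ (p q : Polynomial ℝ), (∀ i, IsAlgebraic ℚ (p.coeff i)) ∧ (∀ i, IsAlgebraic ℚ (q.coeff i)) ∧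
          (∀ x ∈ s.domain, q.eval (x 0) ≠ 0) ∧
          Set.EqOn s.integrand (fun x => p.eval (x 0) / q.eval (x 0)) s.domain) ∨
        ∃ (P Q : MvPolynomial (Fin 2) (algebraicClosure ℚ ℝ)), (∀ x ∈ s.domain, 0 < x 0) ∧
          (∀ x ∈ s.domain, MvPolynomial.aeval ![x 0, Real.sqrt (x 0)] Q ≠ 0) ∧
          Set.EqOn s.integrand (fun x => MvPolynomial.aeval ![x 0, Real.sqrt (x 0)] P /
            MvPolynomial.aeval ![x 0, Real.sqrt (x 0)] Q) s.domain) →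
      KZ.of s ∈ ({d : KZ.FormalRep | (∃ r : KZ.IntegralRep 0, d = KZ.of r) ∨
          ∃ (r : KZ.IntegralRep 1) (p q : Polynomial ℝ), (∀ i, IsAlgebraic ℚ (p.coeff i)) ∧
            (∀ i, IsAlgebraic ℚ (q.coeff i)) ∧ (∀ x ∈ r.domain, q.eval (x 0) ≠ 0) ∧
            Set.EqOn r.integrand (fun x => p.eval (x 0) / q.eval (x 0)) r.domain ∧ d = KZ.of r} ∪
        {d : KZ.FormalRep | ∃ (P Q : MvPolynomial (Fin 2) (algebraicClosure ℚ ℝ))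
            (r : KZ.IntegralRep 1),
          (∀ x ∈ r.domain, 0 < x 0) ∧
          (∀ x ∈ r.domain, MvPolynomial.aeval ![x 0, Real.sqrt (x 0)] Q ≠ 0) ∧
          Set.EqOn r.integrand (fun x => MvPolynomial.aeval ![x 0, Real.sqrt (x 0)] P /
            MvPolynomial.aeval ![x 0, Real.sqrt (x 0)] Q) r.domain ∧ d = KZ.of r}) := by
    rintro s (⟨p, q, hp, hq, hq0, hpq⟩ | ⟨P, Q, hpos, hQ, hPQ⟩)
    · exact Or.inl (Or.inr ⟨s, p, q, hp, hq, hq0, hpq, rfl⟩)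
    · exact Or.inr ⟨P, Q, s, hpos, hQ, hPQ, rfl⟩
  exact sqrtLowDimKernel _
    (sub_mem (AddSubgroup.subset_closure (mem r hr)) (AddSubgroup.subset_closure (mem r' hr')))
    (by rw [map_sub, KZ.eval_of, KZ.eval_of, hv, sub_self])

end Summit.KontsevichZagierPeriods.InverseLandau

end
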